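import Literature.Geometry.Kaehler.ChernCharacterProofs
import Literature.Geometry.Kaehler.GrauertOkaPrinciple
import HarnessLib

/-!
# The Chern character is an isomorphism invariant of cocycle-presented bundles

Layer `Literature/Geometry/Kaehler`. A `C^∞` complex vector bundle is presented in the tree by a
cocycle `V = (U_i, g_ij)` (`ComplexVectorBundle`), and an isomorphism of presented bundles
`V₁ → V₂` by matrices `λ_{a i} : U_i ∩ U'_a → GL_r(ℂ)` with condition (C)
`λ_{a i} g¹_{ij} = g²_{ab} λ_{b j}` (`CocycleIso`, file `GrauertOkaPrinciple`; Fritzsche–Grauert,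
*From Holomorphic Functions to Complex Manifolds* (2002), Ch. IV §2 "Equivalence"). S. Kobayashi,
*Differential Geometry of Complex Vector Bundles* (1987), Ch. II §1: the Chern classes are attached
to (isomorphism classes of) `C^∞` complex vector bundles — for presented bundles: **smoothly
isomorphic cocycles have the same Chern character**. The printed mechanism (Ch. I §1, (1.15)–(1.16):
two systems of frames `s_U`, `s'_V` of the SAME bundle are just two trivialising families, and a
connection is a family `ω_U` over ALL frames obeying the gauge law (1.16)) is formalised verbatim:

* `CocycleIso.IsSmooth` — the `λ_{a i}` are real-`C^∞` on `U_i ∩ U'_a` (entrywise); the inverse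
  isomorphism is then smooth (`IsSmooth.symm`, Cramer's rule), holomorphic isomorphisms are smooth
  (`IsHolomorphic.isSmooth`, Osgood);
* `CocycleIso.glue` — **the union cocycle** on the index type `ι ⊕ ι'`: both trivialising families
  at once, with transition matrices `g¹_{ij}`, `g²_{ab}`, `λ_{a i}` (from the frame `s¹_i` to `s²_a`)
  and `λ_{a i}⁻¹`; the cocycle identities are condition (C) and its consequences
  (`map_mul_coordChange_eq_map`, `map_eq_coordChange_mul_map`);
* `Connection.glueLeft`, `Connection.glueRight` — a connection on the union cocycle restricts to
  connections on `V₁` and on `V₂` (sub-families of the gauge law), and a global Chern character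
  form of it is one of both restrictions (`IsChernCharacterForm.glueLeft/glueRight`);
* `CocycleIso.exists_mem_chernCharacterClassSet_inter` — hence (connections exist on a Hausdorff
  σ-compact base, `nonempty_connection`; Chern–Weil I, `Connection.exists_isChernCharacterForm`)
  **the Chern–Weil classes of `V₁` and `V₂` have a common element in every degree**, and, granted
  Chern–Weil II, `CocycleIso.chernCharacterDeRham_eq`: **`ch_k(V₁) = ch_k(V₂)` in
  `H^{2k}_dR(M; ℂ)`** for smoothly isomorphic cocycles;
* entrywise `C^∞` calculus of complex-matrix-valued functions on a real manifold (finite products,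
  determinant, adjugate, inverse), the complex-valued counterpart of
  `Geometry/Lorentzian/CurvatureRegularity` (Mathlib's `ContMDiffMul` instance for a normed field
  is only for its own model `𝓘(ℂ, ℂ)`, not for `𝓘(ℝ, ℂ)`).

Everything is proved; no named facts.

## References

* S. Kobayashi, *Differential Geometry of Complex Vector Bundles* (1987), Ch. I §1 (1.15)–(1.16),
  Ch. II §1 (Axioms 1–2), §2 Thm. 2.16.
* K. Fritzsche, H. Grauert, *From Holomorphic Functions to Complex Manifolds*, GTM 213 (2002),
  Ch. IV §2 (Equivalence, condition (C)).
-/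

noncomputable section

open scoped Manifold ContDiff Topology Matrix
open Set Filter
open Literature.NumberTheory.Transcendental (complexDeRhamCohomology mem_cclosedSmoothForms
  cclosedSmoothForms)

namespace Literature.Geometry.Kaehler

/-! ### Entrywise `C^∞` calculus of complex matrix functions on a real manifold -/

section MatrixCalculus

variable {E : Type*} [NormedAddCommGroup E] [NormedSpace ℂ E]
  {M : Type*} [TopologicalSpace M] [ChartedSpace E M] {r : ℕ}
  {A : M → Matrix (Fin r) (Fin r) ℂ} {x : M}

/-- A finite product of complex-valued functions `C^∞` at `x` (real structure) is `C^∞` at `x`.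
[folklore] -/
theorem contMDiffAt_finset_prod_complex {κ : Type*} (s : Finset κ) {f : κ → M → ℂ}
    (h : ∀ c ∈ s, ContMDiffAt 𝓘(ℝ, E) 𝓘(ℝ, ℂ) ∞ (f c) x) :
    ContMDiffAt 𝓘(ℝ, E) 𝓘(ℝ, ℂ) ∞ (fun y ↦ ∏ c ∈ s, f c y) x := by
  classical
  induction s using Finset.induction_on with
  | empty =>
    simp only [Finset.prod_empty]
    exact contMDiffAt_const
  | insert a s ha ih =>
    simp only [Finset.prod_insert ha]
    exact contMDiffAt_mul_complex' (h a (Finset.mem_insert_self a s))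
      (ih fun c hc ↦ h c (Finset.mem_insert_of_mem hc))

/-- **The determinant of a matrix of complex functions `C^∞` at `x` is `C^∞` at `x`** (Leibniz
expansion, `Matrix.det_apply'`). [folklore] -/
theorem contMDiffAt_matrix_det_complex (hA : ∀ p q, ContMDiffAt 𝓘(ℝ, E) 𝓘(ℝ, ℂ) ∞ (fun y ↦ A y p q) x) :
    ContMDiffAt 𝓘(ℝ, E) 𝓘(ℝ, ℂ) ∞ (fun y ↦ (A y).det) x := by
  simp only [Matrix.det_apply']
  refine contMDiffAt_finsetSum fun σ _ ↦ ?_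
  exact contMDiffAt_mul_complex' contMDiffAt_const
    (contMDiffAt_finset_prod_complex _ fun i _ ↦ hA (σ i) i)

/-- The entries of the adjugate of a matrix of complex functions `C^∞` at `x` are `C^∞` at `x`
(each is a determinant, `Matrix.adjugate_apply`). [folklore] -/
theorem contMDiffAt_matrix_adjugate_complex
    (hA : ∀ p q, ContMDiffAt 𝓘(ℝ, E) 𝓘(ℝ, ℂ) ∞ (fun y ↦ A y p q) x) (p q : Fin r) :
    ContMDiffAt 𝓘(ℝ, E) 𝓘(ℝ, ℂ) ∞ (fun y ↦ (A y).adjugate p q) x := by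
  simp only [Matrix.adjugate_apply]
  refine contMDiffAt_matrix_det_complex fun p' q' ↦ ?_
  by_cases h : p' = q
  · simp only [h, Matrix.updateRow_self]
    exact contMDiffAt_const
  · simp only [Matrix.updateRow_ne h]
    exact hA p' q'

/-- The inverse of a complex function `C^∞` at `x` (real structure) and non-zero there is `C^∞` at
`x` (inversion is real-analytic on `ℂˣ`). [folklore] -/
theorem contMDiffAt_inv_complex {f : M → ℂ} (hf : ContMDiffAt 𝓘(ℝ, E) 𝓘(ℝ, ℂ) ∞ f x)
    (h0 : f x ≠ 0) : ContMDiffAt 𝓘(ℝ, E) 𝓘(ℝ, ℂ) ∞ (fun y ↦ (f y)⁻¹) x :=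
  (contDiffAt_inv ℝ h0).comp_contMDiffAt hf

/-- **The entries of the inverse of a matrix of complex functions `C^∞` at `x`, invertible at `x`,
are `C^∞` at `x`** (`A⁻¹ = (det A)⁻¹ • adj A`). [folklore] -/
theorem contMDiffAt_matrix_inv_complex (hA : ∀ p q, ContMDiffAt 𝓘(ℝ, E) 𝓘(ℝ, ℂ) ∞ (fun y ↦ A y p q) x)
    (h0 : (A x).det ≠ 0) (p q : Fin r) :
    ContMDiffAt 𝓘(ℝ, E) 𝓘(ℝ, ℂ) ∞ (fun y ↦ (A y)⁻¹ p q) x := by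
  simp only [Matrix.inv_def, Matrix.smul_apply, smul_eq_mul, Ring.inverse_eq_inv']
  exact contMDiffAt_mul_complex' (contMDiffAt_inv_complex (contMDiffAt_matrix_det_complex hA) h0)
    (contMDiffAt_matrix_adjugate_complex hA p q)

end MatrixCalculus

namespace SmoothComplexVectorBundle

variable {ι ι' : Type*} {E : Type*} [NormedAddCommGroup E] [NormedSpace ℂ E]
  {M : Type*} [TopologicalSpace M] [ChartedSpace E M] {r : ℕ}
  {V₁ : SmoothComplexVectorBundle ι E M r} {V₂ : SmoothComplexVectorBundle ι' E M r}

/-! ### Smooth isomorphisms -/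

namespace CocycleIso

/-- The isomorphism is **smooth**: every `λ_{a i}` is real-`C^∞` on `U_i ∩ U'_a`, entrywise (the
`C^∞` version of `IsContinuous` / `IsHolomorphic`). [cite: FritzscheGrauert2002, Ch. IV §2 (Equivalence)] -/
def IsSmooth (Φ : CocycleIso V₁ V₂) : Prop :=
  ∀ a i (p q : Fin r),
    ContMDiffOn 𝓘(ℝ, E) 𝓘(ℝ, ℂ) ∞ (fun x ↦ Φ.map a i x p q) (V₁.baseSet i ∩ V₂.baseSet a)

/-- Pointwise form of smoothness (the overlaps are open). [folklore] -/
theorem IsSmooth.contMDiffAt {Φ : CocycleIso V₁ V₂} (h : Φ.IsSmooth) {a : ι'} {i : ι} {x : M}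
    (hx : x ∈ V₁.baseSet i ∩ V₂.baseSet a) (p q : Fin r) :
    ContMDiffAt 𝓘(ℝ, E) 𝓘(ℝ, ℂ) ∞ (fun y ↦ Φ.map a i y p q) x :=
  (h a i p q).contMDiffAt (((V₁.isOpen_baseSet i).inter (V₂.isOpen_baseSet a)).mem_nhds hx)

/-- The inverse of a smooth isomorphism is smooth (Cramer's rule). [folklore] -/
theorem IsSmooth.symm {Φ : CocycleIso V₁ V₂} (h : Φ.IsSmooth) : Φ.symm.IsSmooth := by
  intro i a p q x hx
  have hx' : x ∈ V₁.baseSet i ∩ V₂.baseSet a := ⟨hx.2, hx.1⟩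
  have h0 : (Φ.map a i x).det ≠ 0 :=
    ((Matrix.isUnit_iff_isUnit_det _).1 (Φ.isUnit_map a i x hx')).ne_zero
  exact (contMDiffAt_matrix_inv_complex (fun p q ↦ h.contMDiffAt hx' p q) h0 p q).contMDiffWithinAt

/-- The identity isomorphism is smooth (the `g_{a i}` are `C^∞`). [folklore] -/
theorem refl_isSmooth (V : SmoothComplexVectorBundle ι E M r) : (CocycleIso.refl V).IsSmooth :=
  fun a i p q ↦ by
  simpa [CocycleIso.refl, inter_comm] using V.contMDiffOn_coordChange a i p q

/-- A holomorphic isomorphism is smooth (holomorphic functions are real-`C^∞`, Osgood).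
[cite: VoisinHodgeI2002, §1.2.1 Thm. 1.17] -/
theorem IsHolomorphic.isSmooth [FiniteDimensional ℂ E] [IsManifold 𝓘(ℝ, E) ∞ M] [IsManifold 𝓘(ℂ, E) ω M]
    {Φ : CocycleIso V₁ V₂} (h : Φ.IsHolomorphic) : Φ.IsSmooth := fun a i p q ↦
  contMDiffOn_real_of_mdifferentiableOn_complex (h a i p q)
    ((V₁.isOpen_baseSet i).inter (V₂.isOpen_baseSet a))

/-! ### The union cocycle of an isomorphism -/

/-- The transition matrices of the **union cocycle** of `Φ : V₁ → V₂` on the index type `ι ⊕ ι'`: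
`g¹_{ij}` between frames of `V₁`, `g²_{ab}` between frames of `V₂`, `λ_{a i}` from the frame `s¹_i` to
the frame `s²_a` and `λ_{a i}⁻¹` back (Kobayashi, Ch. I §1 (1.15): all the frames of one bundle).
[cite: Kobayashi1987, Ch. I §1 (1.15)] -/
def glueCoordChange (Φ : CocycleIso V₁ V₂) : ι ⊕ ι' → ι ⊕ ι' → M → Matrix (Fin r) (Fin r) ℂ
  | Sum.inl i, Sum.inl j => V₁.coordChange i j
  | Sum.inr a, Sum.inr b => V₂.coordChange a b
  | Sum.inr a, Sum.inl i => Φ.map a i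
  | Sum.inl i, Sum.inr a => fun x ↦ (Φ.map a i x)⁻¹

variable (Φ : CocycleIso V₁ V₂)

/-- Transition matrices of the union cocycle within the first family (definitional). [folklore] -/
theorem glueCoordChange_inl_inl (i j : ι) : Φ.glueCoordChange (Sum.inl i) (Sum.inl j) = V₁.coordChange i j :=
  rfl

/-- Transition matrices of the union cocycle within the second family (definitional). [folklore] -/
theorem glueCoordChange_inr_inr (a b : ι') :
    Φ.glueCoordChange (Sum.inr a) (Sum.inr b) = V₂.coordChange a b :=
  rfl

/-- Transition matrix of the union cocycle from a frame of `V₁` to a frame of `V₂`: `λ_{a i}`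
(definitional). [folklore] -/
theorem glueCoordChange_inr_inl (a : ι') (i : ι) : Φ.glueCoordChange (Sum.inr a) (Sum.inl i) = Φ.map a i :=
  rfl

/-- Transition matrix of the union cocycle from a frame of `V₂` to a frame of `V₁`: `λ_{a i}⁻¹`
(definitional). [folklore] -/
theorem glueCoordChange_inl_inr (i : ι) (a : ι') :
    Φ.glueCoordChange (Sum.inl i) (Sum.inr a) = fun x ↦ (Φ.map a i x)⁻¹ :=
  rfl

/-- The determinant of `λ_{a i}(x)` is a unit for `x ∈ U_i ∩ U'_a`. [folklore] -/
theorem isUnit_det_map {a : ι'} {i : ι} {x : M} (hi : x ∈ V₁.baseSet i) (ha : x ∈ V₂.baseSet a) :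
    IsUnit (Φ.map a i x).det :=
  (Matrix.isUnit_iff_isUnit_det _).1 (Φ.isUnit_map a i x ⟨hi, ha⟩)

/-- **The union cocycle of a smooth isomorphism `Φ : V₁ → V₂`**: the trivialising families of `V₁`
and `V₂` together (index type `ι ⊕ ι'`), with the transition matrices `glueCoordChange`. The
cocycle identities are those of `V₁`, of `V₂`, condition (C) `λ_{a i} g¹_{ij} = λ_{a j}`,
`λ_{a i} = g²_{ab} λ_{b i}`, and their consequences for `λ⁻¹` (Kobayashi, Ch. I §1 (1.15); FG Ch. IV
§2: isomorphic systems of transition functions define the same bundle).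
[cite: Kobayashi1987, Ch. I §1 (1.15)] [cite: FritzscheGrauert2002, Ch. IV §2 (Equivalence)] -/
def glue (hΦ : Φ.IsSmooth) : SmoothComplexVectorBundle (ι ⊕ ι') E M r where
  baseSet := Sum.elim V₁.baseSet V₂.baseSet
  isOpen_baseSet k := by
    cases k with
    | inl i => exact V₁.isOpen_baseSet i
    | inr a => exact V₂.isOpen_baseSet a
  exists_mem_baseSet x := by
    obtain ⟨i, hi⟩ := V₁.exists_mem_baseSet x
    exact ⟨Sum.inl i, hi⟩
  coordChange := Φ.glueCoordChange
  contMDiffOn_coordChange k l p q := by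
    cases k with
    | inl i =>
      cases l with
      | inl j => exact V₁.contMDiffOn_coordChange i j p q
      | inr a =>
        change ContMDiffOn 𝓘(ℝ, E) 𝓘(ℝ, ℂ) ∞ (fun x ↦ (Φ.map a i x)⁻¹ p q) (V₁.baseSet i ∩ V₂.baseSet a)
        rw [inter_comm]
        exact hΦ.symm i a p q
    | inr a =>
      cases l with
      | inl i =>
        change ContMDiffOn 𝓘(ℝ, E) 𝓘(ℝ, ℂ) ∞ (fun x ↦ Φ.map a i x p q) (V₂.baseSet a ∩ V₁.baseSet i)
        rw [inter_comm]
        exact hΦ a i p q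
      | inr b => exact V₂.contMDiffOn_coordChange a b p q
  coordChange_self k x hx := by
    cases k with
    | inl i => exact V₁.coordChange_self i x hx
    | inr a => exact V₂.coordChange_self a x hx
  coordChange_comp k l m x hx := by
    obtain ⟨⟨hk, hl⟩, hm⟩ := hx
    cases k with
    | inl i =>
      cases l with
      | inl j =>
        cases m with
        | inl j' => exact V₁.coordChange_comp i j j' x ⟨⟨hk, hl⟩, hm⟩
        | inr a =>
          -- `g¹_{ij} λ_{aj}⁻¹ = λ_{ai}⁻¹`
          change V₁.coordChange i j x * (Φ.map a j x)⁻¹ = (Φ.map a i x)⁻¹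
          have h := Φ.map_mul_coordChange_eq_map hk hl hm
          have hu := Φ.isUnit_det_map hk hm
          have hu' := Φ.isUnit_det_map hl hm
          calc V₁.coordChange i j x * (Φ.map a j x)⁻¹
              = (Φ.map a i x)⁻¹ * (Φ.map a i x * V₁.coordChange i j x) * (Φ.map a j x)⁻¹ := by
                rw [← Matrix.mul_assoc, Matrix.nonsing_inv_mul _ hu, Matrix.one_mul]
            _ = (Φ.map a i x)⁻¹ := by
                rw [h, Matrix.mul_assoc, Matrix.mul_nonsing_inv _ hu', Matrix.mul_one]
      | inr a =>
        cases m with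
        | inl j =>
          -- `λ_{ai}⁻¹ λ_{aj} = g¹_{ij}`
          change (Φ.map a i x)⁻¹ * Φ.map a j x = V₁.coordChange i j x
          have h := Φ.map_mul_coordChange_eq_map hk hm hl
          have hu := Φ.isUnit_det_map hk hl
          rw [← h, ← Matrix.mul_assoc, Matrix.nonsing_inv_mul _ hu, Matrix.one_mul]
        | inr b =>
          -- `λ_{ai}⁻¹ g²_{ab} = λ_{bi}⁻¹`
          change (Φ.map a i x)⁻¹ * V₂.coordChange a b x = (Φ.map b i x)⁻¹
          have h := Φ.map_eq_coordChange_mul_map hk hl hm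
          have hu := Φ.isUnit_det_map hk hl
          have hu' := Φ.isUnit_det_map hk hm
          calc (Φ.map a i x)⁻¹ * V₂.coordChange a b x
              = (Φ.map a i x)⁻¹ * (V₂.coordChange a b x * Φ.map b i x) * (Φ.map b i x)⁻¹ := by
                rw [Matrix.mul_assoc, Matrix.mul_assoc, Matrix.mul_nonsing_inv _ hu', Matrix.mul_one]
            _ = (Φ.map b i x)⁻¹ := by
                rw [← h, Matrix.nonsing_inv_mul _ hu, Matrix.one_mul]
    | inr a =>
      cases l with
      | inl i =>
        cases m with
        | inl j =>
          -- `λ_{ai} g¹_{ij} = λ_{aj}`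
          exact Φ.map_mul_coordChange_eq_map hl hm hk
        | inr b =>
          -- `λ_{ai} λ_{bi}⁻¹ = g²_{ab}`
          change Φ.map a i x * (Φ.map b i x)⁻¹ = V₂.coordChange a b x
          have h := Φ.map_eq_coordChange_mul_map hl hk hm
          have hu' := Φ.isUnit_det_map hl hm
          rw [h, Matrix.mul_assoc, Matrix.mul_nonsing_inv _ hu', Matrix.mul_one]
      | inr b =>
        cases m with
        | inl i =>
          -- `g²_{ab} λ_{bi} = λ_{ai}`
          exact (Φ.map_eq_coordChange_mul_map hm hk hl).symm
        | inr c => exact V₂.coordChange_comp a b c x ⟨⟨hk, hl⟩, hm⟩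

variable (hΦ : Φ.IsSmooth)

/-- Base sets of the union cocycle on the first family (definitional). [folklore] -/
@[simp]
theorem glue_baseSet_inl (i : ι) : (Φ.glue hΦ).baseSet (Sum.inl i) = V₁.baseSet i :=
  rfl

/-- Base sets of the union cocycle on the second family (definitional). [folklore] -/
@[simp]
theorem glue_baseSet_inr (a : ι') : (Φ.glue hΦ).baseSet (Sum.inr a) = V₂.baseSet a :=
  rfl

/-- Transition matrices of the union cocycle (definitional). [folklore] -/
@[simp]
theorem glue_coordChange : (Φ.glue hΦ).coordChange = Φ.glueCoordChange :=
  rfl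

end CocycleIso

/-! ### Connections on the union cocycle restrict to both bundles -/

namespace Connection

variable {Φ : CocycleIso V₁ V₂} {hΦ : Φ.IsSmooth}

/-- A connection on the union cocycle, restricted to the frames of `V₁`, is a connection on `V₁`
(a sub-family of the gauge law (1.16)). [cite: Kobayashi1987, Ch. I §1 (1.16)] -/
def glueLeft (D : (Φ.glue hΦ).Connection) : V₁.Connection where
  form i := D.form (Sum.inl i)
  isSmoothFormOn_form i := D.isSmoothFormOn_form (Sum.inl i)
  form_eq i j := D.form_eq (Sum.inl i) (Sum.inl j)

/-- A connection on the union cocycle, restricted to the frames of `V₂`, is a connection on `V₂`.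
[cite: Kobayashi1987, Ch. I §1 (1.16)] -/
def glueRight (D : (Φ.glue hΦ).Connection) : V₂.Connection where
  form a := D.form (Sum.inr a)
  isSmoothFormOn_form a := D.isSmoothFormOn_form (Sum.inr a)
  form_eq a b := D.form_eq (Sum.inr a) (Sum.inr b)

/-- The connection matrices of the left restriction (definitional). [folklore] -/
@[simp]
theorem glueLeft_form (D : (Φ.glue hΦ).Connection) (i : ι) : D.glueLeft.form i = D.form (Sum.inl i) :=
  rfl

/-- The connection matrices of the right restriction (definitional). [folklore] -/
@[simp]
theorem glueRight_form (D : (Φ.glue hΦ).Connection) (a : ι') : D.glueRight.form a = D.form (Sum.inr a) :=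
  rfl

/-- A global Chern character form of a connection on the union cocycle is one of its restriction to
`V₁` (same local expressions in the frames of `V₁`). [cite: Kobayashi1987, Ch. II §2 (2.21)] -/
theorem IsChernCharacterForm.glueLeft {D : (Φ.glue hΦ).Connection} {p : ℕ}
    {θ : MForm 𝓘(ℝ, E) M ℂ (2 * p)} (h : D.IsChernCharacterForm p θ) :
    D.glueLeft.IsChernCharacterForm p θ := fun i x hx ↦
  h (Sum.inl i) x hx

/-- A global Chern character form of a connection on the union cocycle is one of its restriction to
`V₂`. [cite: Kobayashi1987, Ch. II §2 (2.21)] -/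
theorem IsChernCharacterForm.glueRight {D : (Φ.glue hΦ).Connection} {p : ℕ}
    {θ : MForm 𝓘(ℝ, E) M ℂ (2 * p)} (h : D.IsChernCharacterForm p θ) :
    D.glueRight.IsChernCharacterForm p θ := fun a x hx ↦
  h (Sum.inr a) x hx

end Connection

/-! ### Invariance of the Chern character -/

namespace CocycleIso

/-- **Smoothly isomorphic cocycles have a common Chern–Weil class in every degree**: a connection
`D` on the union cocycle (connections exist over a Hausdorff σ-compact base, `nonempty_connection`)
has a global `k`-th Chern character form `θ` (Chern–Weil I, `Connection.exists_isChernCharacterForm`),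
which is one of `D|_{V₁}` and of `D|_{V₂}`; so `[θ]` belongs to both `chernCharacterClassSet`s.
[cite: Kobayashi1987, Ch. II §1 Axiom 2 and §2 Thm. 2.16] -/
theorem exists_mem_chernCharacterClassSet_inter [FiniteDimensional ℂ E] [IsManifold 𝓘(ℝ, E) ∞ M]
    [T2Space M] [SigmaCompactSpace M] (Φ : CocycleIso V₁ V₂) (hΦ : Φ.IsSmooth) (k : ℕ) :
    ∃ c, c ∈ V₁.chernCharacterClassSet k ∧ c ∈ V₂.chernCharacterClassSet k := by
  obtain ⟨D⟩ := nonempty_connection (Φ.glue hΦ)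
  obtain ⟨θ, hs, hc, hθ⟩ := D.exists_isChernCharacterForm k
  exact ⟨_, mk_mem_chernCharacterClassSet D.glueLeft hs hc hθ.glueLeft,
    mk_mem_chernCharacterClassSet D.glueRight hs hc hθ.glueRight⟩

end CocycleIso

section Univ

universe u v

variable {ι ι' : Type v} {E : Type u} [NormedAddCommGroup E] [NormedSpace ℂ E] [FiniteDimensional ℂ E]
  {M : Type v} [TopologicalSpace M] [ChartedSpace E M] [IsManifold 𝓘(ℝ, E) ∞ M] [T2Space M]
  [SigmaCompactSpace M] {r : ℕ}
  {V₁ : SmoothComplexVectorBundle ι E M r} {V₂ : SmoothComplexVectorBundle ι' E M r}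

/-- **The Chern character is an isomorphism invariant: `ch_k(V₁) = ch_k(V₂)` in `H^{2k}_dR(M; ℂ)`
for smoothly isomorphic cocycles** (Kobayashi, Ch. II §1: the Chern classes of a `C^∞` complex
vector bundle; two presentations of one bundle have the same classes), granted Chern–Weil II
(`mk_eq_mk_of_isChernCharacterForm`, discharged in the tree as
`mk_eq_mk_of_isChernCharacterForm_holds`). [cite: Kobayashi1987, Ch. II §1 Axioms 1–2 and §2 Thm. 2.16] -/
theorem CocycleIso.chernCharacterDeRham_eq (hB : mk_eq_mk_of_isChernCharacterForm E M)
    (Φ : CocycleIso V₁ V₂) (hΦ : Φ.IsSmooth) (k : ℕ) :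
    V₁.chernCharacterDeRham k = V₂.chernCharacterDeRham k := by
  cases k with
  | zero => rw [chernCharacterDeRham_zero, chernCharacterDeRham_zero]
  | succ k =>
    obtain ⟨c, ⟨D₁, θ₁, hs₁, hc₁, hθ₁, rfl⟩, ⟨D₂, θ₂, hs₂, hc₂, hθ₂, h₂⟩⟩ :=
      Φ.exists_mem_chernCharacterClassSet_inter hΦ (k + 1)
    rw [chernCharacterDeRham_eq_mk hB D₁ hs₁ hc₁ hθ₁, chernCharacterDeRham_eq_mk hB D₂ hs₂ hc₂ hθ₂, ← h₂]

/-- **Smoothly isomorphic cocycles have the same Chern–Weil classes**: the sets of classes of global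
`k`-th Chern character forms coincide (both are the singleton `{ch_k}`), granted Chern–Weil II.
[cite: Kobayashi1987, Ch. II §2 Thm. 2.16] -/
theorem CocycleIso.chernCharacterClassSet_eq (hB : mk_eq_mk_of_isChernCharacterForm E M)
    (Φ : CocycleIso V₁ V₂) (hΦ : Φ.IsSmooth) (k : ℕ) :
    V₁.chernCharacterClassSet k = V₂.chernCharacterClassSet k := by
  obtain ⟨c, h₁, h₂⟩ := Φ.exists_mem_chernCharacterClassSet_inter hΦ k
  ext c'
  constructor
  · rintro ⟨D, θ, hs, hc, hθ, rfl⟩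
    obtain ⟨D₁, θ₁, hs₁, hc₁, hθ₁, rfl⟩ := h₁
    rwa [hB V₁ D D₁ k θ θ₁ hs hc hs₁ hc₁ hθ hθ₁]
  · rintro ⟨D, θ, hs, hc, hθ, rfl⟩
    obtain ⟨D₂, θ₂, hs₂, hc₂, hθ₂, rfl⟩ := h₂
    rwa [hB V₂ D D₂ k θ θ₂ hs hc hs₂ hc₂ hθ hθ₂]

end Univ

end SmoothComplexVectorBundle

end Literature.Geometry.Kaehler
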